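import Literature.Computability.Complexity.HardcoreInapproximability
import Literature.ModelTheory.FiniteModelTheory.CFIMatchingGraphs

/-!
# Route PhaseTwins, crux `PolyDepthTwinsAbove` (stmt-PneNP-2719): the parity-wired graphs (definitions)

Objects posited by the line `parity-wired-ports` for the crux `PhaseTwins.PolyDepthTwinsAbove`
(skeleton `Summits/PneNP/PneNP/Cruxes/PolyDepthTwinsAbove/Lines/parity-wired-ports.lean`, whose registered
stubs are stated in exactly this vocabulary and namespace). Cai–Fürer–Immerman/Tseitin CHARGE twins over a
3-regular rotation map `R : RotGraph M 3` with charges `c : Fin M → ZMod 2`, wired directly into the port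
layer of ONE Sly phase gadget `(G, W±, V±)` (`Literature.Computability.Complexity.slyGadgetReduction`):

* `PWVert M v κ₂` — the uniform vertex type: COPY vertices `(δ, a, x)` (vertex `x : Fin v` of the gadget copy
  `g_{δ,a}`, one copy per dart `δ` and bit `a`), END vertices `(w, i, a, j)` and INNER vertices `(w, S', j)` of
  the `j`-th (`j < κ₂`) ten-vertex CFI complex at the base vertex `w` (the inner/end complex of
  `CFIMatching.mgraph`, adjacency `bit (c w) S' i = a`);
* `Wiring v m κ₁ κ₂` — the gadget with its port embeddings and an injective SLOT map (`κ₁` pair slots,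
  `2κ₂` end slots); `slotEmb`; `canonEnd` (which copy/side a dart end plugs into: the CANONICAL dart of its
  edge, `CFIMatching.Canon`);
* `pwRel`/`pwGraph R W c` — the parity-wired graph: the gadget inside each copy, `κ₁ + κ₁` PAIR edges
  `V⁺–V⁺`, `V⁻–V⁻` between `g_{δ,0}` and `g_{δ,1}` (canonical `δ`, same slot on both sides), end `(w,i,a,j)`
  plugged into the `V⁺` port in end slot `(side, j)` of `g_{canon(w,i), a}`, inner–end CFI adjacency;
  `pwBaseRel`/`pwBase` — the disjoint union of the copies (Sly's `Ĥ^G` for this wiring);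
* `copyFib`, `pwPhase` — the configuration on a copy and the PHASE VECTOR (`slyPhase` per copy);
* the explicit product-measure weights: `occP`, `occM`, `pairW` (pair coupling; anti-aligned/aligned ratio
  `slyB^{κ₁}`), `CxVert`/`cxRel`/`cxGraph`/`cxWeight`/`cxW` (the complex and its local factor
  `F_e(λ; x) = Σ_{J independent} λ^{|J|} Π_{(i,a) ∈ J} x(i,a)`), `pwW` (weight of a phase vector), `pwPsi`
  (`Ψ(e)` = log of the complex factor in the off-diagonal reference configuration), `cxRho` (crude range of one
  complex factor), and `PWCutEstimate` (the two conclusions of Sly's Lemma 2.2 for this wiring, shape of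
  `SlyCutEstimate`).

Definitions only (no facts are asserted); the stubs and the composition live in the skeleton and land as
`PhaseTwinsPolyDepthTwinsAbove*.lean`. Sources of the construction: Sly 2010 §2.1–2.2 (gadget, phases,
`Q_V^{±}`, `H^G`); Cai–Fürer–Immerman 1992 §6 / Dawar–Wilsenach 2025 §7.2 (the inner/end complex);
Atserias–Dawar 2019 Lemma 3.2 (why the wiring must be gauge-covariant). [folklore]
-/

noncomputable section

open scoped Classical BigOperators

namespace Summit.PneNP.PneNP.Cruxes.PolyDepthTwinsAbove.ParityWiredPorts

open Finset
open Literature.Computability.Complexity (hardcoreZOn slyPhase)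
open Literature.Computability.Complexity.Expander (RotGraph)
open Literature.ModelTheory.FiniteModelTheory.TseitinColouring (Dart)
open Literature.ModelTheory.FiniteModelTheory.CFIMatching (bit Canon)
open Literature.Probability.LatticeModels (independencePolynomial)

set_option linter.dupNamespace false

variable {M v m κ₁ κ₂ : ℕ}

/-! ## The construction -/

/-- Vertices of the parity-wired graph: COPY vertices `(δ, a, x)` (vertex `x` of the gadget copy `g_{δ,a}`),
END vertices `(w, i, a, j)` and INNER vertices `(w, S', j)` of the `j`-th CFI complex at base vertex `w`. -/
abbrev PWVert (M v κ₂ : ℕ) : Type :=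
  (Dart M 3 × ZMod 2 × Fin v) ⊕ (Fin M × Fin 3 × ZMod 2 × Fin κ₂) ⊕ (Fin M × (Fin 2 → ZMod 2) × Fin κ₂)

/-- A gadget with its wiring data: Sly's `(G, W⁺, W⁻, V⁺, V⁻)` on `Fin v` with `m` ports of each sign, and an
injective SLOT assignment: `κ₁` pair slots and `2κ₂` end slots (side `0` = canonical end, side `1` = other end). -/
structure Wiring (v m κ₁ κ₂ : ℕ) where
  G : SimpleGraph (Fin v)
  Wp : Finset (Fin v)
  Wm : Finset (Fin v)
  Vp : Fin m ↪ Fin v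
  Vm : Fin m ↪ Fin v
  slot : Fin κ₁ ⊕ (Fin 2 × Fin κ₂) ↪ Fin m

/-- The slot assignment from a cardinality bound (slots `0 … κ₁+2κ₂-1`). -/
def slotEmb {κ₁ κ₂ m : ℕ} (h : Fintype.card (Fin κ₁ ⊕ (Fin 2 × Fin κ₂)) ≤ m) :
    Fin κ₁ ⊕ (Fin 2 × Fin κ₂) ↪ Fin m :=
  (Fintype.equivFin (Fin κ₁ ⊕ (Fin 2 × Fin κ₂))).toEmbedding.trans (Fin.castLEEmb h)

/-- The copy an edge-end plugs into: the CANONICAL dart of the edge of `δ` (`CFIMatching.Canon`: below its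
reverse in the `code` order) and the side (`0` if `δ` itself is canonical, `1` otherwise). -/
def canonEnd (R : RotGraph M 3) (δ : Dart M 3) : Dart M 3 × Fin 2 :=
  if Canon R δ then (δ, 0) else (R.rot δ, 1)

/-- Generating adjacency of `pwGraph R W c`: (copy–copy) the gadget inside each copy, and the `κ₁ + κ₁` PAIR
edges `V⁺(slot j) — V⁺(slot j)`, `V⁻(slot j) — V⁻(slot j)` between `g_{δ,0}` and `g_{δ,1}` for canonical `δ`;
(end–copy) the end vertex `(w, i, a, j)` is adjacent to the `V⁺` port in end slot `(side, j)` of the copy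
`g_{canon(w,i), a}`; (inner–end) `(w, S', j) — (w, i, bit (c w) S' i, j)` (the CFI complex, charge `c w`). -/
def pwRel (R : RotGraph M 3) (W : Wiring v m κ₁ κ₂) (c : Fin M → ZMod 2) :
    PWVert M v κ₂ → PWVert M v κ₂ → Prop
  | .inl (δ, a, x), .inl (δ', a', y) =>
      (δ' = δ ∧ a' = a ∧ W.G.Adj x y) ∨
      (Canon R δ ∧ δ' = δ ∧ a' = a + 1 ∧ ∃ j : Fin κ₁,
        (x = W.Vp (W.slot (Sum.inl j)) ∧ y = W.Vp (W.slot (Sum.inl j))) ∨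
        (x = W.Vm (W.slot (Sum.inl j)) ∧ y = W.Vm (W.slot (Sum.inl j))))
  | .inr (.inl (w, i, a, j)), .inl (δ', a', y) =>
      a' = a ∧ δ' = (canonEnd R (w, i)).1 ∧ y = W.Vp (W.slot (Sum.inr ((canonEnd R (w, i)).2, j)))
  | .inr (.inr (w, S', j)), .inr (.inl (w', i, a, j')) => w' = w ∧ j' = j ∧ bit (c w) S' i = a
  | _, _ => False

/-- **The parity-wired graph** over the base `R`, the gadget/wiring `W` and the charges `c`. -/
def pwGraph (R : RotGraph M 3) (W : Wiring v m κ₁ κ₂) (c : Fin M → ZMod 2) : SimpleGraph (PWVert M v κ₂) :=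
  SimpleGraph.fromRel (pwRel R W c)

/-- Generating adjacency of the connector-free, coupling-free graph: the `6M` disjoint gadget copies
(end and inner vertices isolated). -/
def pwBaseRel (M κ₂ : ℕ) (W : Wiring v m κ₁ κ₂) : PWVert M v κ₂ → PWVert M v κ₂ → Prop
  | .inl (δ, a, x), .inl (δ', a', y) => δ' = δ ∧ a' = a ∧ W.G.Adj x y
  | _, _ => False

/-- The disjoint union of the copies (Sly's `Ĥ^G` for this wiring). -/
def pwBase (M κ₂ : ℕ) (W : Wiring v m κ₁ κ₂) : SimpleGraph (PWVert M v κ₂) :=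
  SimpleGraph.fromRel (pwBaseRel M κ₂ W)

/-- The configuration on the copy `g`: its fibre. -/
def copyFib (I : Finset (PWVert M v κ₂)) (g : Dart M 3 × ZMod 2) : Finset (Fin v) :=
  univ.filter fun x => (Sum.inl (g.1, g.2, x) : PWVert M v κ₂) ∈ I

/-- The PHASE VECTOR of a configuration: Sly's phase `Y` (`slyPhase`) of its restriction to every copy. -/
def pwPhase (W : Wiring v m κ₁ κ₂) (I : Finset (PWVert M v κ₂)) : Dart M 3 × ZMod 2 → Bool :=
  fun g => slyPhase W.Wp W.Wm (copyFib I g)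

/-! ## The explicit weights (product-measure values of the wiring, given the phases) -/

/-- Occupation probability of a `V⁺` port in phase `s` (`true` = `+`): `q⁺` resp. `q⁻`. -/
def occP (qp qm : ℝ) (s : Bool) : ℝ := if s then qp else qm

/-- Occupation probability of a `V⁻` port in phase `s`: `q⁻` resp. `q⁺`. -/
def occM (qp qm : ℝ) (s : Bool) : ℝ := if s then qm else qp

/-- The pair-coupling factor of one canonical dart: `κ₁` `V⁺–V⁺` and `κ₁` `V⁻–V⁻` edges, each forbidding double
occupation; equals `((1-q⁺²)(1-q⁻²))^{κ₁}` if the phases agree and `(1-q⁺q⁻)^{2κ₁}` if not (ratio `slyB^{κ₁}`). -/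
def pairW (qp qm : ℝ) (κ₁ : ℕ) (s t : Bool) : ℝ :=
  ((1 - occP qp qm s * occP qp qm t) * (1 - occM qp qm s * occM qp qm t)) ^ κ₁

/-- Vertices of the abstract CFI complex: ends `(i, a)` and inner vertices `S'`. -/
abbrev CxVert : Type := (Fin 3 × ZMod 2) ⊕ (Fin 2 → ZMod 2)

/-- Inner–end adjacency of the complex with local charge `e`: `S' — (i, bit e S' i)`. -/
def cxRel (e : ZMod 2) : CxVert → CxVert → Prop
  | .inr S', .inl (i, a) => bit e S' i = a
  | _, _ => False

/-- The CFI complex with local charge `e` (the inner/end gadget of `CFIMatching.mgraph` at one base vertex). -/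
def cxGraph (e : ZMod 2) : SimpleGraph CxVert := SimpleGraph.fromRel (cxRel e)

/-- The LOCAL FACTOR of the complex: `F_e(λ; x) = Σ_{J independent} λ^{|J|} Π_{(i,a) ∈ J} x(i,a)` — the total
weight of the complex when its end `(i, a)` may be occupied only if the port it plugs into is vacant, which under
the product measure happens with probability `x (i, a)`. -/
def cxWeight (e : ZMod 2) (lam : ℝ) (x : Fin 3 × ZMod 2 → ℝ) : ℝ :=
  ∑ J : Finset CxVert, if (cxGraph e).IsIndepSet (↑J : Set CxVert) then
    lam ^ J.card * ∏ p : Fin 3 × ZMod 2, (if (Sum.inl p : CxVert) ∈ J then x p else 1) else 0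

/-- The complex factor as a function of the PHASES `y (i, a)` of the six copies it touches, normalised by the
`(1+λ)^{10}` the ten complex vertices contribute to `Z(pwBase)` as isolated vertices. -/
def cxW (lam qp qm : ℝ) (e : ZMod 2) (y : Fin 3 × ZMod 2 → Bool) : ℝ :=
  cxWeight e lam (fun p => 1 - occP qp qm (y p)) / (1 + lam) ^ 10

/-- **The weight of a phase vector** `Y` under charges `c`: pair factors of the canonical darts times the
`κ₂`-th powers of the complex factors (the complex at `w` reads the phases of the copies `g_{canon(w,i), a}`). -/
def pwW (R : RotGraph M 3) (lam qp qm : ℝ) (κ₁ κ₂ : ℕ) (c : Fin M → ZMod 2)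
    (Y : Dart M 3 × ZMod 2 → Bool) : ℝ :=
  (∏ δ : Dart M 3, if Canon R δ then pairW qp qm κ₁ (Y (δ, 0)) (Y (δ, 1)) else 1) *
    ∏ w : Fin M, cxW lam qp qm (c w) (fun p => Y ((canonEnd R (w, p.1)).1, p.2)) ^ κ₂

/-- `Ψ(e)`: log of the complex factor in the off-diagonal reference configuration (copy `g_{·,0}` in phase `+`,
copy `g_{·,1}` in phase `−`) with local charge `e`; by the Tseitin covariance of the complex the factor at `w` in
an off-diagonal configuration with plus-copy bits `b` is `exp Ψ(c w + Σ_i b_i)`. -/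
def pwPsi (lam qp qm : ℝ) (e : ZMod 2) : ℝ :=
  Real.log (cxW lam qp qm e fun p => decide (p.2 = 0))

/-- `ρ_F = F(all ports in phase −)/F(all ports in phase +)` (`≥ 1`): the crude range of one complex factor. -/
def cxRho (lam qp qm : ℝ) : ℝ :=
  cxW lam qp qm 0 (fun _ => false) / cxW lam qp qm 0 (fun _ => true)

/-- **The conclusions of Sly's Lemma 2.2 for the parity wiring** (shape of `SlyCutEstimate`): for every phase
vector `Y`, `(phaseProbs)` `Z_{base}(Y) ≥ n^{-6M} Z_{base}` (`6M` copies, `(GpropA)`), and `(cutProb)`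
`|Z_{pwGraph c}(Y) − pwW c Y · Z_{base}(Y)| ≤ ε · pwW c Y · Z_{base}(Y)`. -/
def PWCutEstimate (R : RotGraph M 3) (W : Wiring v m κ₁ κ₂) (lam qp qm ε : ℝ) (n : ℕ)
    (c : Fin M → ZMod 2) : Prop :=
  ∀ Y : Dart M 3 × ZMod 2 → Bool,
    ((n : ℝ) ^ (6 * M))⁻¹ * independencePolynomial (pwBase M κ₂ W) lam ≤
        hardcoreZOn (pwBase M κ₂ W) lam (fun I => pwPhase W I = Y) ∧
      |hardcoreZOn (pwGraph R W c) lam (fun I => pwPhase W I = Y) -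
          pwW R lam qp qm κ₁ κ₂ c Y * hardcoreZOn (pwBase M κ₂ W) lam (fun I => pwPhase W I = Y)| ≤
        ε * (pwW R lam qp qm κ₁ κ₂ c Y * hardcoreZOn (pwBase M κ₂ W) lam (fun I => pwPhase W I = Y))

/-! ## Unfolding -/

/-- Adjacency of the parity-wired graph: the symmetrised, irreflexive closure of the generating relation
`pwRel` (registered anchor lemma of this definitions file). -/
theorem pwGraph_adj (R : RotGraph M 3) (W : Wiring v m κ₁ κ₂) (c : Fin M → ZMod 2) (x y : PWVert M v κ₂) :
    (pwGraph R W c).Adj x y ↔ x ≠ y ∧ (pwRel R W c x y ∨ pwRel R W c y x) :=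
  SimpleGraph.fromRel_adj _ _ _

/-- Adjacency of the disjoint union of the copies. -/
theorem pwBase_adj (M κ₂ : ℕ) (W : Wiring v m κ₁ κ₂) (x y : PWVert M v κ₂) :
    (pwBase M κ₂ W).Adj x y ↔ x ≠ y ∧ (pwBaseRel M κ₂ W x y ∨ pwBaseRel M κ₂ W y x) :=
  SimpleGraph.fromRel_adj _ _ _

/-- Adjacency of the CFI complex with local charge `e`. -/
theorem cxGraph_adj (e : ZMod 2) (x y : CxVert) :
    (cxGraph e).Adj x y ↔ x ≠ y ∧ (cxRel e x y ∨ cxRel e y x) :=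
  SimpleGraph.fromRel_adj _ _ _

end Summit.PneNP.PneNP.Cruxes.PolyDepthTwinsAbove.ParityWiredPorts
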